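import Summits.KontsevichZagierPeriods.Zeta5Search.WedgeDictionaryThreeTerm
import Summits.KontsevichZagierPeriods.Zeta5Search.WedgeDictionaryKernelCellsStar12
import Summits.KontsevichZagierPeriods.Zeta5Search.WedgeDictionaryKernelCellsStar17
import Summits.KontsevichZagierPeriods.Zeta5Search.WedgeDictionaryKernelCellsStar27
import Summits.KontsevichZagierPeriods.Zeta5Search.WedgeDictionaryKernelCellsStar34
import Summits.KontsevichZagierPeriods.Zeta5Search.WedgeDictionaryKernelCellsStar35
import Summits.KontsevichZagierPeriods.Zeta5Search.WedgeDictionaryKernelCellsStar45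
import Summits.KontsevichZagierPeriods.Zeta5Search.WedgeDictionaryKernelTransport

/-!
# The six native `CellStar` cells in the reversed orientation (cell `pub-zeta5`, lineage gen-1, g21)

HONEST FRAMING: systematic search; no irrationality claim unless certified.  Structure of gen-1's period dictionary
(`WedgeDictionary.explicitPQ`, an OPEN conjecture node) only; nothing about linear forms or ζ(5); nothing is evaluated.

`cellStar_native_ki` for `(i,k) ∈ {(1,2),(1,7),(2,7),(3,4),(3,5),(4,5)}`: the same three members, coefficients
`(starKappa k i, −fanCoeff i, fanCoeff k)`; from `cellStar_native_ik` by `cellStar_swap` (antisymmetry of `starKappa`).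
Hypotheses as in the native cells (F1, F2, convergence and a common rational chamber point of the three members).
-/

set_option maxHeartbeats 8000000
set_option linter.unusedSimpArgs false
set_option linter.unusedTactic false
set_option linter.unreachableTactic false
set_option linter.unnecessarySeqFocus false
set_option linter.style.longLine false
set_option linter.unusedVariables false

namespace Summit.KontsevichZagierPeriods.Zeta5Search.WedgeDictionary.KernelCells

open Literature.NumberTheory.Irrationality.BrownZudilin2022 MeasureTheory
open Summit.KontsevichZagierPeriods.Zeta5Search.WedgeDictionary.Kernel

/-- `CellStar` at the slot pair `(2,1)` (orientation-reversed native cell), symbolic `a`, from F1+F2. -/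
theorem cellStar_native_21 (h8 : cellularIntegral_eq_cubicalIntegral) (h10 : cubicalIntegral_eq_Jintegral)
    (hF2 : barnes_double) (a : Fin 8 → ℤ) (c₁ c₂ : ℚ)
    (hc0 : Converges a) (hc1 : Converges (a + slotDown 1)) (hc2 : Converges (a + slotDown 2))
    (hch0 : ChamberQ (pOf a) (qOf a) c₁ c₂)
    (hch1 : ChamberQ (pOf (a + slotDown 1)) (qOf (a + slotDown 1)) c₁ c₂)
    (hch2 : ChamberQ (pOf (a + slotDown 2)) (qOf (a + slotDown 2)) c₁ c₂) :
    ThreeTermRel (starKappa (bOfA a) 2 1) (-fanCoeff (bOfA a) 1) (fanCoeff (bOfA a) 2) a (a + slotDown 1) (a + slotDown 2) :=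
  cellStar_swap (cellStar_native_12 h8 h10 hF2 a c₁ c₂ hc0 hc2 hc1 hch0 hch2 hch1)

/-- `CellStar` at the slot pair `(7,1)` (orientation-reversed native cell), symbolic `a`, from F1+F2. -/
theorem cellStar_native_71 (h8 : cellularIntegral_eq_cubicalIntegral) (h10 : cubicalIntegral_eq_Jintegral)
    (hF2 : barnes_double) (a : Fin 8 → ℤ) (c₁ c₂ : ℚ)
    (hc0 : Converges a) (hc1 : Converges (a + slotDown 1)) (hc2 : Converges (a + slotDown 7))
    (hch0 : ChamberQ (pOf a) (qOf a) c₁ c₂)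
    (hch1 : ChamberQ (pOf (a + slotDown 1)) (qOf (a + slotDown 1)) c₁ c₂)
    (hch2 : ChamberQ (pOf (a + slotDown 7)) (qOf (a + slotDown 7)) c₁ c₂) :
    ThreeTermRel (starKappa (bOfA a) 7 1) (-fanCoeff (bOfA a) 1) (fanCoeff (bOfA a) 7) a (a + slotDown 1) (a + slotDown 7) :=
  cellStar_swap (cellStar_native_17 h8 h10 hF2 a c₁ c₂ hc0 hc2 hc1 hch0 hch2 hch1)

/-- `CellStar` at the slot pair `(7,2)` (orientation-reversed native cell), symbolic `a`, from F1+F2. -/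
theorem cellStar_native_72 (h8 : cellularIntegral_eq_cubicalIntegral) (h10 : cubicalIntegral_eq_Jintegral)
    (hF2 : barnes_double) (a : Fin 8 → ℤ) (c₁ c₂ : ℚ)
    (hc0 : Converges a) (hc1 : Converges (a + slotDown 2)) (hc2 : Converges (a + slotDown 7))
    (hch0 : ChamberQ (pOf a) (qOf a) c₁ c₂)
    (hch1 : ChamberQ (pOf (a + slotDown 2)) (qOf (a + slotDown 2)) c₁ c₂)
    (hch2 : ChamberQ (pOf (a + slotDown 7)) (qOf (a + slotDown 7)) c₁ c₂) :
    ThreeTermRel (starKappa (bOfA a) 7 2) (-fanCoeff (bOfA a) 2) (fanCoeff (bOfA a) 7) a (a + slotDown 2) (a + slotDown 7) :=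
  cellStar_swap (cellStar_native_27 h8 h10 hF2 a c₁ c₂ hc0 hc2 hc1 hch0 hch2 hch1)

/-- `CellStar` at the slot pair `(4,3)` (orientation-reversed native cell), symbolic `a`, from F1+F2. -/
theorem cellStar_native_43 (h8 : cellularIntegral_eq_cubicalIntegral) (h10 : cubicalIntegral_eq_Jintegral)
    (hF2 : barnes_double) (a : Fin 8 → ℤ) (c₁ c₂ : ℚ)
    (hc0 : Converges a) (hc1 : Converges (a + slotDown 3)) (hc2 : Converges (a + slotDown 4))
    (hch0 : ChamberQ (pOf a) (qOf a) c₁ c₂)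
    (hch1 : ChamberQ (pOf (a + slotDown 3)) (qOf (a + slotDown 3)) c₁ c₂)
    (hch2 : ChamberQ (pOf (a + slotDown 4)) (qOf (a + slotDown 4)) c₁ c₂) :
    ThreeTermRel (starKappa (bOfA a) 4 3) (-fanCoeff (bOfA a) 3) (fanCoeff (bOfA a) 4) a (a + slotDown 3) (a + slotDown 4) :=
  cellStar_swap (cellStar_native_34 h8 h10 hF2 a c₁ c₂ hc0 hc2 hc1 hch0 hch2 hch1)

/-- `CellStar` at the slot pair `(5,3)` (orientation-reversed native cell), symbolic `a`, from F1+F2. -/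
theorem cellStar_native_53 (h8 : cellularIntegral_eq_cubicalIntegral) (h10 : cubicalIntegral_eq_Jintegral)
    (hF2 : barnes_double) (a : Fin 8 → ℤ) (c₁ c₂ : ℚ)
    (hc0 : Converges a) (hc1 : Converges (a + slotDown 3)) (hc2 : Converges (a + slotDown 5))
    (hch0 : ChamberQ (pOf a) (qOf a) c₁ c₂)
    (hch1 : ChamberQ (pOf (a + slotDown 3)) (qOf (a + slotDown 3)) c₁ c₂)
    (hch2 : ChamberQ (pOf (a + slotDown 5)) (qOf (a + slotDown 5)) c₁ c₂) :
    ThreeTermRel (starKappa (bOfA a) 5 3) (-fanCoeff (bOfA a) 3) (fanCoeff (bOfA a) 5) a (a + slotDown 3) (a + slotDown 5) :=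
  cellStar_swap (cellStar_native_35 h8 h10 hF2 a c₁ c₂ hc0 hc2 hc1 hch0 hch2 hch1)

/-- `CellStar` at the slot pair `(5,4)` (orientation-reversed native cell), symbolic `a`, from F1+F2. -/
theorem cellStar_native_54 (h8 : cellularIntegral_eq_cubicalIntegral) (h10 : cubicalIntegral_eq_Jintegral)
    (hF2 : barnes_double) (a : Fin 8 → ℤ) (c₁ c₂ : ℚ)
    (hc0 : Converges a) (hc1 : Converges (a + slotDown 4)) (hc2 : Converges (a + slotDown 5))
    (hch0 : ChamberQ (pOf a) (qOf a) c₁ c₂)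
    (hch1 : ChamberQ (pOf (a + slotDown 4)) (qOf (a + slotDown 4)) c₁ c₂)
    (hch2 : ChamberQ (pOf (a + slotDown 5)) (qOf (a + slotDown 5)) c₁ c₂) :
    ThreeTermRel (starKappa (bOfA a) 5 4) (-fanCoeff (bOfA a) 4) (fanCoeff (bOfA a) 5) a (a + slotDown 4) (a + slotDown 5) :=
  cellStar_swap (cellStar_native_45 h8 h10 hF2 a c₁ c₂ hc0 hc2 hc1 hch0 hch2 hch1)

end Summit.KontsevichZagierPeriods.Zeta5Search.WedgeDictionary.KernelCells
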